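import Summits.AtomisticToContinuum.FouriersLaw.Theorems.VanishingNoiseTransferNoiseLocalityFeketeReductionAux
import Summits.AtomisticToContinuum.FouriersLaw.Theorems.VanishingNoiseTransferNoiseLocalityStubFlipSteadyStateWellPosed
import Summits.AtomisticToContinuum.FouriersLaw.Theorems.VanishingNoiseTransferNoiseLocalityStubPositiveNoisyConductance
import Summits.AtomisticToContinuum.FouriersLaw.Theorems.VanishingNoiseTransferNoiseLocalityStubResponseContinuousInNoise

/-!
# `NoiseLocality` (stmt-AtomisticToContinuum-11975) REDUCED to the uniform two-sided series law — importable record of line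
# `fekete-transposed-uniformity` with its three fixed-`N` stubs discharged (lead prover-line-stmt-AtomisticToContinuum-11975-c1-0, 2026-08-17).
# Main theorems at the end: `noiseLocality_of_uniformSeriesLaw`, `siblings_of_uniformSeriesLaw` (both CONDITIONAL on stub 4).
# Below: the planner's skeleton text (v3), namespace moved under `Theorems.NoiseLocality.FeketeReduction`, stub texts not re-declared.
#
# Line `fekete-transposed-uniformity` for crux `VanishingNoiseTransfer.NoiseLocality`
(stmt-AtomisticToContinuum-11975, route `route-AtomisticToContinuum-VanishingNoiseTransfer`, rank 2) — v3 (gen-2 planner)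

Crux (X1, read back from `Theses/VanishingNoiseTransfer.lean`): for `pinnedChain ω₂ lam β γ` (all `> 0`)
with the flip-noisy weak steady-state predicate `S` (`= IsFlipSteadyState` by `rfl`,
`isFlipSteadyState_fun_eq`) and every `T > 0` there is ONE modulus `w`, `w → 0` at `0⁺`, such that for
EVERY `N`, every `ε ∈ (0,1]`, the unique deterministic / rate-`ε` steady families at this `N` and their
response coefficients `D0, Dε` at `T`: `|D0 − Dε| ≤ w(ε)·|D0|·|Dε|` (division-free
`|1/D_N(ε) − 1/D_N(0)| ≤ w(ε)`, `w` UNIFORM IN `N`).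

THE LINE (idea card `Ideas/fekete-transposed-uniformity.md`, triage r1: pass / pass / pass).  Do not
differentiate in the noise.  Along the unique flip-steady families let `R_N(ε) := (N−1)/D_N(ε)`
(bath-to-bath resistance).  If the TWO-SIDED SERIES LAW `|R_{N+M}(ε) − R_N(ε) − R_M(ε)| ≤ C` holds with
ONE junction constant for all `ε ∈ (0,1]`, `N, M ≥ 2`, and `ε ↦ D_N(ε)` is continuous on `[0,1]` at
each fixed `N`, then the law also holds at `ε = 0` (closure), `|R_N(ε) − Nℓ(ε)| ≤ C` on `[0,1]`
(two-sided Fekete with rate), `r_N := 1/D_N → ℓ` UNIFORMLY on `[0,1]`, `ℓ` is continuous and `(r_N)_N`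
is equicontinuous at `0`, which is X1 with `w(ε) := sup_N |r_N(ε) − r_N(0)|`.  That transfer is PROVED in
this file (`equicontinuity_of_seriesLaw`, v3); what remains are four registered stubs:

* `stub_flipSteadyStateWellPosed` (XL formal / print-level, fixed `N`) — for every `N`, every rate
  `ε ∈ [0,1]` and `T_L, T_R > 0` the weak steady state of `L + εS` exists and is unique.  At `ε > 0`
  this is clause (i) of the route's X3 `NoisyFourier`; at `ε = 0` it is the landed
  `pinnedChain_exists_isSteadyState` plus the shared support `NessUnique` (stmt-0741) —
  `wellPosed_of_noisyFourier_nessUnique` below (proved).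
* `stub_responseContinuousInNoise` (L, fixed `N`; LOAD-BEARING by triage r1-2's mutation test, re-checked
  here as `seriesLaw_without_continuity_insufficient`) — for every `N` and `T > 0` there is `D : ℝ → ℝ`,
  CONTINUOUS ON `[0,1]`, which is the linear-response coefficient of every unique flip-steady family at
  each rate `ε ∈ [0,1]`.
* `stub_positiveNoisyConductance` (M, fixed `N`) — `D_N(ε) > 0` for `N ≥ 2`, `ε ∈ [0,1]`.
* `stub_uniformSeriesLawPositiveNoise` (XL, HARDEST — the line's one N-uniform load) — `∃ C = C(T)` such
  that for EVERY `ε ∈ (0,1]`, along the unique rate-`ε` flip-steady family with positive responses,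
  `|R_{N+M} − R_N − R_M| ≤ C` for all `N, M ≥ 2`.

CHANGES (gen-2, v3 vs the gen-1 file): (a) gen-1's stub `stub_seriesLawAtZero` (= stmt-14041 ∧
stmt-11748, the deterministic two-sided law) is DROPPED as a registered stub because it is IMPLIED by the
four stubs above: the three-chain defect is continuous in `ε` on `[0,1]` at fixed `N, M` (stubs 2, 3), so a
bound on `(0,1]` passes to `ε = 0` (`abs_le_of_abs_le_Ioc`, `canonical_of_stubs`, proved).  The honest price
flagged by all three triagers is now KERNEL-CHECKED instead of registered: `siblings_of_stubs : stub 1 →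
stub 2 → stub 3 → stub 4 → QuasiSubadditiveResistance ∧ SuperadditiveResistance` — the line's hardest stub
(with the fixed-`N` stubs) proves the two open rank-2 sibling cruxes BY NAME.  (b) gen-1's stub
`stub_equicontinuityOfSeriesLaw` (the Fekete/equicontinuity transfer) is PROVED (`equicontinuity_of_seriesLaw`,
≈ 230 lines, Mathlib only).  Consequence for the lead: the crux closes as soon as the four stubs land (no
wait on 14041/11748, no real-analysis debt); conversely landed sibling theorems are importable lemmas for the
`ε → 0⁺` end of the hardest stub.

COMPOSITION `NoiseLocality_of` (sorry-free): `canonical_of_stubs` (canonical flip-steady family by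
choice from stub 1; responses `Dc N : ℝ → ℝ` from stub 2; positivity from stub 3; the law on `(0,1]`
from stub 4, extended to `[0,1]` by closure); `equicontinuity_of_seriesLaw` at `r N ε := (Dc N ε)⁻¹` gives
`w`; then for the crux's own `μ0, με, D0, Dε`: `N ≤ 1` is currentless (`totalCurrent ≡ 0`, Disproof §1),
and for `N ≥ 2` uniqueness of limits along `𝓝[≠] 0` identifies `D0 = Dc N 0`, `Dε = Dc N ε`, whence the
WEIGHTED form `|D0 − Dε| = |D0||Dε|·|Dε⁻¹ − D0⁻¹| ≤ w(ε)|D0||Dε|` (Disproof §4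
`additive_form_fails_ballistic`: the weights are kept, never the additive form).

Disproof used.  `Cruxes/NoiseLocality/Disproof.lean` v4 (cdisprove-11975-0, 2026-08-16T05:02Z, published in the
crux dir at 05:03 and READ in full this session; v1–v3 were evidence-store only and reached gen-1 and the
triagers as notes).  It is sorry-free with no `_false_without_<H>` theorem, no `-- Targets` section and no
landed `Theorems/NoiseLocality/Negative/*` (§6: the crux RESISTS — uniqueness hypotheses unwitnessable for
`N ≥ 2`), so there is no `H` to place at a stub.  Honoured: §1 (`conclusion_of_le_one`) — the `N ≤ 1` branch of `NoiseLocality_of` is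
proved, not stubbed; §4 `pointwise_modulus_insufficient` (N-uniformity cannot be dropped) — stub 4 puts
`∃ C` BEFORE `∀ ε, N, M` and `equicontinuity_of_seriesLaw` outputs ONE `w` for all `N ≥ 2`; §4 `localityShape_ballistic` —
consistent: the series law holds in the ballistic harmonic corner (`R_N(0)` bounded, `ℓ(0) = 0` allowed;
no finiteness of `κ₀` is used or produced — that stays with X2); §4 `additive_form_fails_ballistic` —
weighted form proved; §5b `localityShape_of_parts` (road map: fixed-`N` continuity + continuity of `1/κ_ε`
at `0⁺` + convergence uniform in `ε` ⇒ shape) — this line IS that road map with the last two inputs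
DERIVED from the two-sided law (proved transfer), the first being stub 2; §6 (v4) HarmonicExact table —
consistent with stub 4 in the crux's own harmonic corner (`R_N(0) → 8` bounded, `(N−1)(c_∞ − c_N(ε)) ≈ 4.5–5.0`
for `N = 4, 8, 12` at `ε = 0.01`: bounded contact correction, i.e. a three-chain defect `−8 + O(10)ε`).
Landed `Theorems/NoiseLocality/Negative/`: none (checked 2026-08-16); nothing to import.  `ledger negatives`: the only FouriersLaw negative
(DiluteCellGaussianiser far-field Gaussianity, stmt-12890) has no contact with any stub.
-/

noncomputable section

namespace Summit.AtomisticToContinuum.FouriersLaw.Theorems.NoiseLocality.FeketeReduction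

open Filter Topology MeasureTheory
open Literature.MathematicalPhysics.KineticTheory.HeatConduction

/-! ## Core of the composition (proved): canonical responses and the series law on the CLOSED interval -/

/-- **Stubs 1–4 ⇒ canonical continuous positive responses obeying the two-sided series law on `[0,1]`
with ONE constant.**  Canonical flip-steady family by choice (stub 1); responses `Dc N : ℝ → ℝ` continuous on
`[0,1]` (stub 2) and identified with the response of every unique family; positivity for `N ≥ 2` (stub 3);
the law on `(0,1]` (stub 4) extends to `ε = 0` because the three-chain defect is continuous in `ε`
(`abs_le_of_abs_le_Ioc`). [folklore] -/
theorem canonical_of_stubs (h1 : type_of% Summit.AtomisticToContinuum.FouriersLaw.Theorems.NoiseLocality.stub_flipSteadyStateWellPosed) (h2 : type_of% Summit.AtomisticToContinuum.FouriersLaw.Theorems.NoiseLocality.stub_responseContinuousInNoise)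
    (h3 : type_of% Summit.AtomisticToContinuum.FouriersLaw.Theorems.NoiseLocality.stub_positiveNoisyConductance) (h4 : ∀ ω₂ lam β γ : ℝ, 0 < ω₂ → 0 < lam → 0 < β → 0 < γ → ∀ T : ℝ, 0 < T →
          ∃ C : ℝ, ∀ ε : ℝ, 0 < ε → ε ≤ 1 →
          ∀ μ : (N : ℕ) → ℝ → ℝ →
              MeasureTheory.Measure (Literature.MathematicalPhysics.KineticTheory.HeatConduction.PhaseSpace N),
          (∀ (N : ℕ) (T_L T_R : ℝ), 0 < T_L → 0 < T_R →
            (Literature.MathematicalPhysics.KineticTheory.HeatConduction.pinnedChain ω₂ lam β γ).IsFlipSteadyState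
                N T_L T_R ε (μ N T_L T_R) ∧
              ∀ ν : MeasureTheory.Measure (Literature.MathematicalPhysics.KineticTheory.HeatConduction.PhaseSpace N),
                (Literature.MathematicalPhysics.KineticTheory.HeatConduction.pinnedChain ω₂ lam β γ).IsFlipSteadyState
                  N T_L T_R ε ν → ν = μ N T_L T_R) →
          ∀ D : ℕ → ℝ,
          (∀ N : ℕ, Filter.Tendsto (fun δ : ℝ =>
              (Literature.MathematicalPhysics.KineticTheory.HeatConduction.pinnedChain ω₂ lam β γ).totalCurrent
                (μ N (T + δ / 2) (T - δ / 2)) / δ) (nhdsWithin 0 {(0 : ℝ)}ᶜ) (nhds (D N))) →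
          (∀ N : ℕ, 2 ≤ N → 0 < D N) →
          ∀ N M : ℕ, 2 ≤ N → 2 ≤ M →
            |((N : ℝ) + (M : ℝ) - 1) / D (N + M) - ((N : ℝ) - 1) / D N - ((M : ℝ) - 1) / D M| ≤ C)
    {ω₂ lam β γ : ℝ} (hω : 0 < ω₂) (hl : 0 < lam) (hβ : 0 < β) (hγ : 0 < γ) {T : ℝ} (hT : 0 < T) :
    ∃ (Dc : ℕ → ℝ → ℝ) (C : ℝ),
      (∀ N : ℕ, ContinuousOn (Dc N) (Set.Icc 0 1)) ∧
      (∀ N : ℕ, 2 ≤ N → ∀ ε : ℝ, 0 ≤ ε → ε ≤ 1 → 0 < Dc N ε) ∧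
      (∀ (N : ℕ) (ε : ℝ), 0 ≤ ε → ε ≤ 1 →
        ∀ μ : ℝ → ℝ → Measure (PhaseSpace N),
          (∀ T_L T_R : ℝ, 0 < T_L → 0 < T_R →
            (pinnedChain ω₂ lam β γ).IsFlipSteadyState N T_L T_R ε (μ T_L T_R) ∧
              ∀ ν : Measure (PhaseSpace N),
                (pinnedChain ω₂ lam β γ).IsFlipSteadyState N T_L T_R ε ν → ν = μ T_L T_R) →
          Tendsto (fun δ : ℝ =>
            (pinnedChain ω₂ lam β γ).totalCurrent (μ (T + δ / 2) (T - δ / 2)) / δ) (𝓝[≠] 0)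
            (𝓝 (Dc N ε))) ∧
      (∀ ε : ℝ, 0 ≤ ε → ε ≤ 1 → ∀ N M : ℕ, 2 ≤ N → 2 ≤ M →
        |((N : ℝ) + (M : ℝ) - 1) / Dc (N + M) ε - ((N : ℝ) - 1) / Dc N ε - ((M : ℝ) - 1) / Dc M ε| ≤ C) := by
  -- (0) the canonical flip-steady family `μc N ε T_L T_R` (stub 1 + choice; junk outside the box)
  have hex : ∀ (N : ℕ) (ε T_L T_R : ℝ), ∃ μ : Measure (PhaseSpace N),
      (0 ≤ ε → ε ≤ 1 → 0 < T_L → 0 < T_R →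
        (pinnedChain ω₂ lam β γ).IsFlipSteadyState N T_L T_R ε μ ∧
          ∀ ν : Measure (PhaseSpace N),
            (pinnedChain ω₂ lam β γ).IsFlipSteadyState N T_L T_R ε ν → ν = μ) := by
    intro N ε T_L T_R
    by_cases h : 0 ≤ ε ∧ ε ≤ 1 ∧ 0 < T_L ∧ 0 < T_R
    · obtain ⟨μ, hμ⟩ := h1 ω₂ lam β γ hω hl hβ hγ N ε h.1 h.2.1 T_L T_R h.2.2.1 h.2.2.2
      exact ⟨μ, fun _ _ _ _ => hμ⟩
    · exact ⟨0, fun h0 h1' hL hR => (h ⟨h0, h1', hL, hR⟩).elim⟩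
  choose μc hμc using hex
  have hfam : ∀ (N : ℕ) (ε : ℝ), 0 ≤ ε → ε ≤ 1 → ∀ T_L T_R : ℝ, 0 < T_L → 0 < T_R →
      (pinnedChain ω₂ lam β γ).IsFlipSteadyState N T_L T_R ε (μc N ε T_L T_R) ∧
        ∀ ν : Measure (PhaseSpace N),
          (pinnedChain ω₂ lam β γ).IsFlipSteadyState N T_L T_R ε ν → ν = μc N ε T_L T_R :=
    fun N ε h0 h1' T_L T_R hL hR => hμc N ε T_L T_R h0 h1' hL hR
  -- (1) canonical responses `Dc N : ℝ → ℝ`, continuous on `[0,1]` (stub 2)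
  choose Dc hDc_cont hDc using fun N : ℕ => h2 ω₂ lam β γ hω hl hβ hγ N T hT
  have hDc_can : ∀ (N : ℕ) (ε : ℝ), 0 ≤ ε → ε ≤ 1 →
      Tendsto (fun δ : ℝ => (pinnedChain ω₂ lam β γ).totalCurrent
        (μc N ε (T + δ / 2) (T - δ / 2)) / δ) (𝓝[≠] 0) (𝓝 (Dc N ε)) :=
    fun N ε h0 h1' => hDc N ε h0 h1' (μc N ε) (hfam N ε h0 h1')
  -- (2) positivity of the canonical responses for `N ≥ 2` (stub 3)
  have hpos : ∀ N : ℕ, 2 ≤ N → ∀ ε : ℝ, 0 ≤ ε → ε ≤ 1 → 0 < Dc N ε :=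
    fun N hN ε h0 h1' => h3 ω₂ lam β γ hω hl hβ hγ N hN ε h0 h1' T hT (μc N ε) (hfam N ε h0 h1')
      (Dc N ε) (hDc_can N ε h0 h1')
  -- (3) the series law on `(0,1]`, one constant (stub 4)
  obtain ⟨C, hC⟩ := h4 ω₂ lam β γ hω hl hβ hγ T hT
  have hC' : ∀ ε : ℝ, 0 < ε → ε ≤ 1 → ∀ N M : ℕ, 2 ≤ N → 2 ≤ M →
      |((N : ℝ) + (M : ℝ) - 1) / Dc (N + M) ε - ((N : ℝ) - 1) / Dc N ε - ((M : ℝ) - 1) / Dc M ε| ≤ C :=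
    fun ε hε hε1 => hC ε hε hε1 (fun N T_L T_R => μc N ε T_L T_R)
      (fun N T_L T_R hL hR => hfam N ε hε.le hε1 T_L T_R hL hR) (fun N => Dc N ε)
      (fun N => hDc_can N ε hε.le hε1) (fun N hN => hpos N hN ε hε.le hε1)
  -- (4) extension to `ε = 0` by continuity of the three-chain defect
  refine ⟨Dc, C, hDc_cont, hpos, hDc, ?_⟩
  intro ε hε0 hε1 N M hN hM
  rcases hε0.lt_or_eq with hε | hε
  · exact hC' ε hε hε1 N M hN hM
  · subst hε
    have hne : ∀ K : ℕ, 2 ≤ K → ∀ ε ∈ Set.Icc (0 : ℝ) 1, Dc K ε ≠ 0 :=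
      fun K hK ε hε => (hpos K hK ε hε.1 hε.2).ne'
    have hF : ContinuousOn (fun ε : ℝ => ((N : ℝ) + (M : ℝ) - 1) / Dc (N + M) ε
        - ((N : ℝ) - 1) / Dc N ε - ((M : ℝ) - 1) / Dc M ε) (Set.Icc 0 1) :=
      ((continuousOn_const.div (hDc_cont (N + M)) (hne (N + M) (by omega))).sub
        (continuousOn_const.div (hDc_cont N) (hne N hN))).sub
        (continuousOn_const.div (hDc_cont M) (hne M hM))
    exact abs_le_of_abs_le_Ioc hF (fun ε hε => hC' ε hε.1 hε.2 N M hN hM)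

/-! ## The honest price, kernel-checked: stubs 1–4 prove both open sibling cruxes -/

/-- **Stubs 1–4 ⟹ stmt-14041 `FeketeSeriesLaw.QuasiSubadditiveResistance` ∧ stmt-11748
`JunctionLocality.SuperadditiveResistance`.**  Under the siblings' global weak-NESS uniqueness, every steady
family is the canonical rate-`0` flip-steady family (`isFlipSteadyState_zero_iff`) and its responses are the
canonical ones (uniqueness of limits along `𝓝[≠] 0`), so the `ε = 0` end of `canonical_of_stubs` gives both
one-sided laws with the same constant (casts `((N - 1 : ℕ) : ℝ) = N - 1` for `N ≥ 2`).  This replaces gen-1's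
registered stub `stub_seriesLawAtZero` (the conjunction of the two siblings), which was implied by the other
stubs. [folklore] -/
theorem siblings_of_stubs (h1 : type_of% Summit.AtomisticToContinuum.FouriersLaw.Theorems.NoiseLocality.stub_flipSteadyStateWellPosed) (h2 : type_of% Summit.AtomisticToContinuum.FouriersLaw.Theorems.NoiseLocality.stub_responseContinuousInNoise)
    (h3 : type_of% Summit.AtomisticToContinuum.FouriersLaw.Theorems.NoiseLocality.stub_positiveNoisyConductance) (h4 : ∀ ω₂ lam β γ : ℝ, 0 < ω₂ → 0 < lam → 0 < β → 0 < γ → ∀ T : ℝ, 0 < T →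
          ∃ C : ℝ, ∀ ε : ℝ, 0 < ε → ε ≤ 1 →
          ∀ μ : (N : ℕ) → ℝ → ℝ →
              MeasureTheory.Measure (Literature.MathematicalPhysics.KineticTheory.HeatConduction.PhaseSpace N),
          (∀ (N : ℕ) (T_L T_R : ℝ), 0 < T_L → 0 < T_R →
            (Literature.MathematicalPhysics.KineticTheory.HeatConduction.pinnedChain ω₂ lam β γ).IsFlipSteadyState
                N T_L T_R ε (μ N T_L T_R) ∧
              ∀ ν : MeasureTheory.Measure (Literature.MathematicalPhysics.KineticTheory.HeatConduction.PhaseSpace N),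
                (Literature.MathematicalPhysics.KineticTheory.HeatConduction.pinnedChain ω₂ lam β γ).IsFlipSteadyState
                  N T_L T_R ε ν → ν = μ N T_L T_R) →
          ∀ D : ℕ → ℝ,
          (∀ N : ℕ, Filter.Tendsto (fun δ : ℝ =>
              (Literature.MathematicalPhysics.KineticTheory.HeatConduction.pinnedChain ω₂ lam β γ).totalCurrent
                (μ N (T + δ / 2) (T - δ / 2)) / δ) (nhdsWithin 0 {(0 : ℝ)}ᶜ) (nhds (D N))) →
          (∀ N : ℕ, 2 ≤ N → 0 < D N) →
          ∀ N M : ℕ, 2 ≤ N → 2 ≤ M →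
            |((N : ℝ) + (M : ℝ) - 1) / D (N + M) - ((N : ℝ) - 1) / D N - ((M : ℝ) - 1) / D M| ≤ C) :
    Summit.AtomisticToContinuum.FouriersLaw.Theses.FeketeSeriesLaw.QuasiSubadditiveResistance ∧
      Summit.AtomisticToContinuum.FouriersLaw.Theses.JunctionLocality.SuperadditiveResistance := by
  -- common core in the siblings' vocabulary
  have key : ∀ ω₂ lam β γ : ℝ, 0 < ω₂ → 0 < lam → 0 < β → 0 < γ →
      (∀ (N : ℕ) (T_L T_R : ℝ), 0 < T_L → 0 < T_R →
        ∀ μ ν : Measure (PhaseSpace N),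
          (pinnedChain ω₂ lam β γ).IsSteadyState N T_L T_R μ →
          (pinnedChain ω₂ lam β γ).IsSteadyState N T_L T_R ν → μ = ν) →
      ∀ μ : (N : ℕ) → ℝ → ℝ → Measure (PhaseSpace N),
      (∀ (N : ℕ) (T_L T_R : ℝ), 0 < T_L → 0 < T_R →
        (pinnedChain ω₂ lam β γ).IsSteadyState N T_L T_R (μ N T_L T_R)) →
      ∀ T : ℝ, 0 < T → ∀ D : ℕ → ℝ,
      (∀ N : ℕ, Tendsto (fun δ : ℝ =>
          (pinnedChain ω₂ lam β γ).totalCurrent (μ N (T + δ / 2) (T - δ / 2)) / δ) (𝓝[≠] 0) (𝓝 (D N))) →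
      (∀ N : ℕ, 2 ≤ N → 0 < D N) ∧
        ∃ C : ℝ, ∀ N M : ℕ, 2 ≤ N → 2 ≤ M →
          |((N : ℝ) + (M : ℝ) - 1) / D (N + M) - ((N : ℝ) - 1) / D N - ((M : ℝ) - 1) / D M| ≤ C := by
    intro ω₂ lam β γ hω hl hβ hγ huniq μ hμ T hT D hD
    obtain ⟨Dc, C, -, hpos, hcan, hlaw⟩ := canonical_of_stubs h1 h2 h3 h4 hω hl hβ hγ hT
    have hid : ∀ N : ℕ, D N = Dc N 0 := by
      intro N
      refine tendsto_nhds_unique (hD N) (hcan N 0 le_rfl zero_le_one (μ N) ?_)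
      intro T_L T_R hL hR
      refine ⟨((pinnedChain ω₂ lam β γ).isFlipSteadyState_zero_iff N T_L T_R _).2 (hμ N T_L T_R hL hR),
        fun ν hν => ?_⟩
      exact huniq N T_L T_R hL hR ν (μ N T_L T_R)
        (((pinnedChain ω₂ lam β γ).isFlipSteadyState_zero_iff N T_L T_R ν).1 hν) (hμ N T_L T_R hL hR)
    refine ⟨fun N hN => (hid N) ▸ hpos N hN 0 le_rfl zero_le_one, C, fun N M hN hM => ?_⟩
    simp only [hid]
    exact hlaw 0 le_rfl zero_le_one N M hN hM
  constructor
  · intro ω₂ lam β γ hω hl hβ hγ huniq μ hμ T hT D hD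
    obtain ⟨-, C, hC⟩ := key ω₂ lam β γ hω hl hβ hγ huniq μ hμ T hT D hD
    refine ⟨C, fun N M hN hM => ?_⟩
    have e1 : ((N - 1 : ℕ) : ℝ) = (N : ℝ) - 1 := by
      rw [Nat.cast_sub (by omega : 1 ≤ N), Nat.cast_one]
    have e2 : ((M - 1 : ℕ) : ℝ) = (M : ℝ) - 1 := by
      rw [Nat.cast_sub (by omega : 1 ≤ M), Nat.cast_one]
    have e3 : ((N + M - 1 : ℕ) : ℝ) = (N : ℝ) + (M : ℝ) - 1 := by
      rw [Nat.cast_sub (by omega : 1 ≤ N + M), Nat.cast_add, Nat.cast_one]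
    have h := hC N M hN hM
    rw [abs_le] at h
    rw [e1, e2, e3]
    linarith [h.1, h.2]
  · intro ω₂ lam β γ hω hl hβ hγ huniq μ hμ T hT D hD _hposD
    obtain ⟨-, C, hC⟩ := key ω₂ lam β γ hω hl hβ hγ huniq μ hμ T hT D hD
    refine ⟨C, fun N M hN hM => ?_⟩
    have h := hC N M hN hM
    rw [abs_le] at h
    linarith [h.1, h.2]

/-! ## Composition (sorry-free): the four stubs give the crux BY NAME -/

/-- **`NoiseLocality_of`** — stubs 1–4 ⟹ `VanishingNoiseTransfer.NoiseLocality` (kernel-checked).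
`canonical_of_stubs` (stubs 1–4) gives continuous positive canonical responses `Dc N` obeying the two-sided
law on `[0,1]` with one `C`; the proved transfer `equicontinuity_of_seriesLaw` at `r N ε := (Dc N ε)⁻¹`
yields `w`; finally the crux's
own `μ0, με, D0, Dε` are identified with the canonical ones by uniqueness of limits along `𝓝[≠] 0`
(`N ≥ 2`), and `N ≤ 1` is currentless. [folklore] -/
theorem NoiseLocality_of (h1 : type_of% Summit.AtomisticToContinuum.FouriersLaw.Theorems.NoiseLocality.stub_flipSteadyStateWellPosed) (h2 : type_of% Summit.AtomisticToContinuum.FouriersLaw.Theorems.NoiseLocality.stub_responseContinuousInNoise)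
    (h3 : type_of% Summit.AtomisticToContinuum.FouriersLaw.Theorems.NoiseLocality.stub_positiveNoisyConductance) (h4 : ∀ ω₂ lam β γ : ℝ, 0 < ω₂ → 0 < lam → 0 < β → 0 < γ → ∀ T : ℝ, 0 < T →
          ∃ C : ℝ, ∀ ε : ℝ, 0 < ε → ε ≤ 1 →
          ∀ μ : (N : ℕ) → ℝ → ℝ →
              MeasureTheory.Measure (Literature.MathematicalPhysics.KineticTheory.HeatConduction.PhaseSpace N),
          (∀ (N : ℕ) (T_L T_R : ℝ), 0 < T_L → 0 < T_R →
            (Literature.MathematicalPhysics.KineticTheory.HeatConduction.pinnedChain ω₂ lam β γ).IsFlipSteadyState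
                N T_L T_R ε (μ N T_L T_R) ∧
              ∀ ν : MeasureTheory.Measure (Literature.MathematicalPhysics.KineticTheory.HeatConduction.PhaseSpace N),
                (Literature.MathematicalPhysics.KineticTheory.HeatConduction.pinnedChain ω₂ lam β γ).IsFlipSteadyState
                  N T_L T_R ε ν → ν = μ N T_L T_R) →
          ∀ D : ℕ → ℝ,
          (∀ N : ℕ, Filter.Tendsto (fun δ : ℝ =>
              (Literature.MathematicalPhysics.KineticTheory.HeatConduction.pinnedChain ω₂ lam β γ).totalCurrent
                (μ N (T + δ / 2) (T - δ / 2)) / δ) (nhdsWithin 0 {(0 : ℝ)}ᶜ) (nhds (D N))) →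
          (∀ N : ℕ, 2 ≤ N → 0 < D N) →
          ∀ N M : ℕ, 2 ≤ N → 2 ≤ M →
            |((N : ℝ) + (M : ℝ) - 1) / D (N + M) - ((N : ℝ) - 1) / D N - ((M : ℝ) - 1) / D M| ≤ C) :
    Summit.AtomisticToContinuum.FouriersLaw.Theses.VanishingNoiseTransfer.NoiseLocality := by
  intro ω₂ lam β γ hω hl hβ hγ S hS T hT
  subst hS
  obtain ⟨Dc, C, hcont, hpos, hcan, hlaw⟩ := canonical_of_stubs h1 h2 h3 h4 hω hl hβ hγ hT
  -- the transfer (proved) at `r N ε := (Dc N ε)⁻¹`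
  have hcont' : ∀ N : ℕ, 2 ≤ N → ContinuousOn (fun ε : ℝ => (Dc N ε)⁻¹) (Set.Icc 0 1) :=
    fun N hN => (hcont N).inv₀ fun ε hε => (hpos N hN ε hε.1 hε.2).ne'
  have hlaw' : ∀ ε ∈ Set.Icc (0 : ℝ) 1, ∀ N M : ℕ, 2 ≤ N → 2 ≤ M →
      |((N : ℝ) + (M : ℝ) - 1) * (Dc (N + M) ε)⁻¹ - ((N : ℝ) - 1) * (Dc N ε)⁻¹ -
          ((M : ℝ) - 1) * (Dc M ε)⁻¹| ≤ C := by
    intro ε hε N M hN hM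
    simp only [← div_eq_mul_inv]
    exact hlaw ε hε.1 hε.2 N M hN hM
  obtain ⟨w, hw, hwb⟩ := equicontinuity_of_seriesLaw (fun N ε => (Dc N ε)⁻¹) C hcont' hlaw'
  -- the crux for its own `μ0, με, D0, Dε`
  refine ⟨w, hw, ?_⟩
  intro N ε hε hε1 μ0 με hμ0 hμε D0 Dε hD0 hDε
  by_cases hN : 2 ≤ N
  · -- `μ0` is a unique flip-steady family at rate 0, `με` at rate `ε`: identify the responses
    have hμ0' : ∀ T_L T_R : ℝ, 0 < T_L → 0 < T_R →
        (pinnedChain ω₂ lam β γ).IsFlipSteadyState N T_L T_R 0 (μ0 T_L T_R) ∧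
          ∀ ν : Measure (PhaseSpace N),
            (pinnedChain ω₂ lam β γ).IsFlipSteadyState N T_L T_R 0 ν → ν = μ0 T_L T_R := by
      intro T_L T_R hL hR
      refine ⟨((pinnedChain ω₂ lam β γ).isFlipSteadyState_zero_iff N T_L T_R _).2 (hμ0 T_L T_R hL hR).1,
        fun ν hν => (hμ0 T_L T_R hL hR).2 ν ?_⟩
      exact ((pinnedChain ω₂ lam β γ).isFlipSteadyState_zero_iff N T_L T_R ν).1 hν
    have hμε' : ∀ T_L T_R : ℝ, 0 < T_L → 0 < T_R →
        (pinnedChain ω₂ lam β γ).IsFlipSteadyState N T_L T_R ε (με T_L T_R) ∧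
          ∀ ν : Measure (PhaseSpace N),
            (pinnedChain ω₂ lam β γ).IsFlipSteadyState N T_L T_R ε ν → ν = με T_L T_R :=
      hμε
    have hD0eq : D0 = Dc N 0 := tendsto_nhds_unique hD0 (hcan N 0 le_rfl zero_le_one μ0 hμ0')
    have hDεeq : Dε = Dc N ε := tendsto_nhds_unique hDε (hcan N ε hε.le hε1 με hμε')
    have hD0pos : 0 < D0 := hD0eq ▸ hpos N hN 0 le_rfl zero_le_one
    have hDεpos : 0 < Dε := hDεeq ▸ hpos N hN ε hε.le hε1
    have hb : |Dε⁻¹ - D0⁻¹| ≤ w ε := by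
      rw [hD0eq, hDεeq]
      exact hwb N hN ε hε hε1
    have key : D0 - Dε = D0 * Dε * (Dε⁻¹ - D0⁻¹) := by
      rw [mul_sub, mul_assoc, mul_inv_cancel₀ hDεpos.ne', mul_one, mul_comm D0 Dε, mul_assoc,
        mul_inv_cancel₀ hD0pos.ne', mul_one]
    rw [key, abs_mul, abs_mul]
    calc |D0| * |Dε| * |Dε⁻¹ - D0⁻¹| ≤ |D0| * |Dε| * w ε := by gcongr
      _ = w ε * |D0| * |Dε| := by ring
  · -- `N ≤ 1`: no bond, no current, `D0 = Dε = 0`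
    have hN1 : N ≤ 1 := by omega
    have h0 : D0 = 0 := response_eq_zero_of_le_one _ hN1 μ0 T D0 hD0
    have hε0 : Dε = 0 := response_eq_zero_of_le_one _ hN1 με T Dε hDε
    simp [h0, hε0]

/-- **The crux REDUCED to one N-uniform statement.** With the three fixed-`N` stubs of line `fekete-transposed-uniformity`
LANDED (`…Theorems.NoiseLocality.stub_flipSteadyStateWellPosed` p133081, `…stub_responseContinuousInNoise` p134029,
`…stub_positiveNoisyConductance` p133179), the registered stub 4 — the two-sided series law with a junction constant uniform in
the flip rate `ε ∈ (0,1]` (hypothesis `h4`, verbatim the registered text) — ALONE implies the crux `NoiseLocality`.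
CONDITIONAL result (stub 4 is open and crux-sized); nothing here closes the item. [folklore] -/
theorem noiseLocality_of_uniformSeriesLaw
    (h4 : ∀ ω₂ lam β γ : ℝ, 0 < ω₂ → 0 < lam → 0 < β → 0 < γ → ∀ T : ℝ, 0 < T →
          ∃ C : ℝ, ∀ ε : ℝ, 0 < ε → ε ≤ 1 →
          ∀ μ : (N : ℕ) → ℝ → ℝ →
              MeasureTheory.Measure (Literature.MathematicalPhysics.KineticTheory.HeatConduction.PhaseSpace N),
          (∀ (N : ℕ) (T_L T_R : ℝ), 0 < T_L → 0 < T_R →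
            (Literature.MathematicalPhysics.KineticTheory.HeatConduction.pinnedChain ω₂ lam β γ).IsFlipSteadyState
                N T_L T_R ε (μ N T_L T_R) ∧
              ∀ ν : MeasureTheory.Measure (Literature.MathematicalPhysics.KineticTheory.HeatConduction.PhaseSpace N),
                (Literature.MathematicalPhysics.KineticTheory.HeatConduction.pinnedChain ω₂ lam β γ).IsFlipSteadyState
                  N T_L T_R ε ν → ν = μ N T_L T_R) →
          ∀ D : ℕ → ℝ,
          (∀ N : ℕ, Filter.Tendsto (fun δ : ℝ =>
              (Literature.MathematicalPhysics.KineticTheory.HeatConduction.pinnedChain ω₂ lam β γ).totalCurrent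
                (μ N (T + δ / 2) (T - δ / 2)) / δ) (nhdsWithin 0 {(0 : ℝ)}ᶜ) (nhds (D N))) →
          (∀ N : ℕ, 2 ≤ N → 0 < D N) →
          ∀ N M : ℕ, 2 ≤ N → 2 ≤ M →
            |((N : ℝ) + (M : ℝ) - 1) / D (N + M) - ((N : ℝ) - 1) / D N - ((M : ℝ) - 1) / D M| ≤ C) :
    Summit.AtomisticToContinuum.FouriersLaw.Theses.VanishingNoiseTransfer.NoiseLocality :=
  NoiseLocality_of Summit.AtomisticToContinuum.FouriersLaw.Theorems.NoiseLocality.stub_flipSteadyStateWellPosed Summit.AtomisticToContinuum.FouriersLaw.Theorems.NoiseLocality.stub_responseContinuousInNoise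
    Summit.AtomisticToContinuum.FouriersLaw.Theorems.NoiseLocality.stub_positiveNoisyConductance h4

/-- **… and the same hypothesis proves the two open rank-2 sibling cruxes** `FeketeSeriesLaw.QuasiSubadditiveResistance`
(stmt-AtomisticToContinuum-14041) and `JunctionLocality.SuperadditiveResistance` (stmt-11748) by name (the honest price of the line,
`siblings_of_stubs`, now with stubs 1–3 discharged). CONDITIONAL. [folklore] -/
theorem siblings_of_uniformSeriesLaw
    (h4 : ∀ ω₂ lam β γ : ℝ, 0 < ω₂ → 0 < lam → 0 < β → 0 < γ → ∀ T : ℝ, 0 < T →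
          ∃ C : ℝ, ∀ ε : ℝ, 0 < ε → ε ≤ 1 →
          ∀ μ : (N : ℕ) → ℝ → ℝ →
              MeasureTheory.Measure (Literature.MathematicalPhysics.KineticTheory.HeatConduction.PhaseSpace N),
          (∀ (N : ℕ) (T_L T_R : ℝ), 0 < T_L → 0 < T_R →
            (Literature.MathematicalPhysics.KineticTheory.HeatConduction.pinnedChain ω₂ lam β γ).IsFlipSteadyState
                N T_L T_R ε (μ N T_L T_R) ∧
              ∀ ν : MeasureTheory.Measure (Literature.MathematicalPhysics.KineticTheory.HeatConduction.PhaseSpace N),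
                (Literature.MathematicalPhysics.KineticTheory.HeatConduction.pinnedChain ω₂ lam β γ).IsFlipSteadyState
                  N T_L T_R ε ν → ν = μ N T_L T_R) →
          ∀ D : ℕ → ℝ,
          (∀ N : ℕ, Filter.Tendsto (fun δ : ℝ =>
              (Literature.MathematicalPhysics.KineticTheory.HeatConduction.pinnedChain ω₂ lam β γ).totalCurrent
                (μ N (T + δ / 2) (T - δ / 2)) / δ) (nhdsWithin 0 {(0 : ℝ)}ᶜ) (nhds (D N))) →
          (∀ N : ℕ, 2 ≤ N → 0 < D N) →
          ∀ N M : ℕ, 2 ≤ N → 2 ≤ M →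
            |((N : ℝ) + (M : ℝ) - 1) / D (N + M) - ((N : ℝ) - 1) / D N - ((M : ℝ) - 1) / D M| ≤ C) :
    Summit.AtomisticToContinuum.FouriersLaw.Theses.FeketeSeriesLaw.QuasiSubadditiveResistance ∧
      Summit.AtomisticToContinuum.FouriersLaw.Theses.JunctionLocality.SuperadditiveResistance :=
  siblings_of_stubs Summit.AtomisticToContinuum.FouriersLaw.Theorems.NoiseLocality.stub_flipSteadyStateWellPosed Summit.AtomisticToContinuum.FouriersLaw.Theorems.NoiseLocality.stub_responseContinuousInNoise
    Summit.AtomisticToContinuum.FouriersLaw.Theorems.NoiseLocality.stub_positiveNoisyConductance h4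

/-- Registered helper sub-goal `helper_noiseLocalityOfUniformSeriesLaw` of crux stmt-AtomisticToContinuum-11975 (line
`fekete-transposed-uniformity`, lead c1): the registered open stub 4 ALONE (its text as hypothesis) gives the crux AND both sibling
cruxes 14041 ∧ 11748 — `noiseLocality_of_uniformSeriesLaw` ∧ `siblings_of_uniformSeriesLaw` in registry form. CONDITIONAL. [folklore] -/
theorem helper_noiseLocalityOfUniformSeriesLaw : (∀ ω₂ lam β γ : ℝ, 0 < ω₂ → 0 < lam → 0 < β → 0 < γ → ∀ T : ℝ, 0 < T → ∃ C : ℝ, ∀ ε : ℝ, 0 < ε → ε ≤ 1 → ∀ μ : (N : ℕ) → ℝ → ℝ → MeasureTheory.Measure (Literature.MathematicalPhysics.KineticTheory.HeatConduction.PhaseSpace N), (∀ (N : ℕ) (T_L T_R : ℝ), 0 < T_L → 0 < T_R → (Literature.MathematicalPhysics.KineticTheory.HeatConduction.pinnedChain ω₂ lam β γ).IsFlipSteadyState N T_L T_R ε (μ N T_L T_R) ∧ ∀ ν : MeasureTheory.Measure (Literature.MathematicalPhysics.KineticTheory.HeatConduction.PhaseSpace N), (Literature.MathematicalPhysics.KineticTheory.HeatConduction.pinnedChain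 ω₂ lam β γ).IsFlipSteadyState N T_L T_R ε ν → ν = μ N T_L T_R) → ∀ D : ℕ → ℝ, (∀ N : ℕ, Filter.Tendsto (fun δ : ℝ => (Literature.MathematicalPhysics.KineticTheory.HeatConduction.pinnedChain ω₂ lam β γ).totalCurrent (μ N (T + δ / 2) (T - δ / 2)) / δ) (nhdsWithin 0 {(0 : ℝ)}ᶜ) (nhds (D N))) → (∀ N : ℕ, 2 ≤ N → 0 < D N) → ∀ N M : ℕ, 2 ≤ N → 2 ≤ M → |((N : ℝ) + (M : ℝ) - 1) / D (N + M) - ((N : ℝ) - 1) / D N - ((M : ℝ) - 1) / D M| ≤ C) → Summit.AtomisticToContinuum.FouriersLaw.Theses.VanishingNoiseTransfer.NoiseLocality ∧ Summit.AtomisticToContinuum.FouriersLaw.Theses.FeketeSeriesLaw.QuasiSubadditiveResistance ∧ Summit.AtomisticToContinuum.FouriersLaw.Theses.JunctionLocality.SuperadditiveResistance :=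
  fun h4 => ⟨noiseLocality_of_uniformSeriesLaw h4, siblings_of_uniformSeriesLaw h4⟩

end Summit.AtomisticToContinuum.FouriersLaw.Theorems.NoiseLocality.FeketeReduction

end
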